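import Summits.HodgeConjecture.CorCM.HypLiu418.RecordSystemAlongConjComplex
import Summits.HodgeConjecture.CorCM.B01.Transposition.HComp.RecordSystemConjRecip
import HarnessLib

/-!
# B2 «same models, conjugate embedding» — reciprocity (B2-62) and the record system along `τ̄` (B2-R)

Cell `hodgecm-mathlib`, fan A, off-place half of `HLiu418` (director g1 2026-08-28T03:49:27Z; design of record A-p06
`A-provers/A-p06/B2-DESIGN-alongConj.md`, spec `RecordSystemAlongConjSpec.lean`).  For Deligne's record system `R` of
`Sh(U(H), 𝔹²)` below `K₀` read at `(τ, T)` ([Deligne1979ShimuraVarieties] 2.2.5: models `M_K` over `L`, the «form» isomorphisms,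
Shimura reciprocity (62) at the diagonal special pairs), the SAME models `K ↦ M_K` form a record system read at the CONJUGATE
embedding `τ̄ = conj ∘ τ` with the conjugate frame `T̄ = conjFrame T`:

* §1 (points) the form isomorphism `(M_K)_{τ̄} ≅ ((M_K)_τ)^{conj}` (✔ `modelsAlongConjIso`, components ✔ `baseChangeHomObjIsoOfComp`)
  read on complex points is the twist `P ↦ Spec(conj) ≫ P` of wb-1 (`D2Bridge.twist`): `twist_conjEmb_eq_baseChangeEquiv_symm`;
* §2 (Galois) `σ ↦ conj ∘ σ ∘ conj : Aut(ℂ/τ̄L) → Aut(ℂ/τL)` (✔ `algEquivTwist`) is undone by the twist back, and carries the Artin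
  correspondence at `τ̄` to the one at `τ` for the SAME finite idèle `s` (`isArtinCorrespondent_of_conjEmb` — elementary: compose the
  `L`-embedding `L̄ → ℂ` with `conj`; no class field theory);
* §3 the diagonal CM pairs: `x` is a line point of `v₃` for `(τ̄, T̄)` iff `x̄` is one for `(τ, T)` (same `v₃`, same twist `d`);
* §4 **`recip_alongConj`** = (62) for `(H, τ̄, T̄)` read through `modelsAlongConjIso` and `(alongConj R_ℂ).pts`, from `R.recip` by
  ✔ `twist_smul`; **`RecordSystem.exists_alongConj`** `: ∃ R', R'.M = R.M` := ✔ `recordSystem_exists_of_descent` at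
  `Sc := ComplexRecordSystem.alongConj R.complexRecordSystem`, `e := modelsAlongConjIso R.M τ`.

KERNEL: theorems only; no def, no instance, no named fact, no `sorry`.  HC_CM is NOT proved here; HC_CM is proved only modulo the
7 printed citations until rung 0 closes.

References: [Deligne1979ShimuraVarieties] 2.2.4–2.2.5; [Milne2005ShimuraVarieties] Def. 12.8 (62) p. 114, §12 and Lemma 5.13;
[SerreGAGA1956] §2.
-/

set_option autoImplicit false

noncomputable section

open CategoryTheory AlgebraicGeometry NumberField IsDedekindDomain Matrix
open Literature.AlgebraicGeometry.Motives
open Literature.NumberTheory.Automorphic.Liu2021.AppendixC (C5.OpenCompactSubgroup C5.SmallLevel)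

namespace Summit.HodgeConjecture.CorCM.Model.RecordSystemConj

open Limits Function MulAction Topology
open scoped Matrix ComplexConjugate
open Literature.AlgebraicGeometry.ShimuraVarieties Literature.AlgebraicGeometry.ShimuraVarieties.UnitaryCanonicalModel
open Literature.AlgebraicGeometry.Motives.AlgPoints (toConjugate ofConjugate conjugateHomeomorph)
open Literature.NumberTheory.Automorphic Literature.NumberTheory.Automorphic.UnitaryGroup
open Literature.NumberTheory.Automorphic.ShimuraDissection
open Literature.Geometry.ComplexHyperbolic Literature.Geometry.ComplexHyperbolic.BallModel
open Summit.HodgeConjecture.CorCM.D2Bridge Summit.HodgeConjecture.CorCM.D2Bridge.UnitaryGroupConj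

/-! ## §1 Points: `(M_K)_{τ̄} ≅ ((M_K)_τ)^{conj}` on complex points is the twist `P ↦ Spec(conj) ≫ P` -/

section Points

variable {L : Type} [Field L] (τ : L →+* ℂ)

/-- **The form isomorphism on points.**  For an `L`-scheme `X` and a complex point `P ∈ X(ℂ)_τ` (values in `ℂ` through `τ`):
carrying `P` to `X_τ(ℂ)` (`baseChangeEquiv τ`), conjugating (`toConjugate conj : X_τ(ℂ) → (X_τ)^{conj}(ℂ)`, Serre), moving along
`(X_τ)^{conj} ≅ X_{τ̄}` (`baseChangeHomObjIsoOfComp τ conj τ̄`, Görtz–Wedhorn Prop. 4.16) and reading the result in `X(ℂ)_{τ̄}`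
(`(baseChangeEquiv τ̄)⁻¹`) gives the TWIST `Spec(conj) ≫ P` of wb-1 — all four maps lie over the projections to `X`.
[cite: GortzWedhorn2020, Prop. 4.16 and §(4.7)] [cite: SerreGAGA1956, §2] -/
theorem twist_conjEmb_eq_baseChangeEquiv_symm (X : SchemeOver L) (P : PointsAlong X τ) :
    (AlgPoints.baseChangeEquiv (conjEmb τ) X).symm
        (AlgPoints.map (baseChangeHomObjIsoOfComp τ (conjAut : ℂ ≃+* ℂ).toRingHom (conjEmb τ) rfl X).hom
          (toConjugate conjAut ((baseChangeHom τ).obj X) (AlgPoints.baseChangeEquiv τ X P))) =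
      twist (conjEmb_eq τ) P := by
  apply Over.OverMorphism.ext
  -- the conjugated point lies over `Spec(conj) ≫ P` (two projections: `(X_τ)^{conj} → X_τ → X`); stated on a point `Q'` TYPED on
  -- `baseChangeHom conj` so that the compositions below are spelled as in the goal
  have h4 : ∀ Q' : ComplexPoints ((baseChangeHom (conjAut : ℂ ≃+* ℂ).toRingHom).obj ((baseChangeHom τ).obj X)),
      Q' = toConjugate conjAut ((baseChangeHom τ).obj X) (AlgPoints.baseChangeEquiv τ X P) →
      Q'.left ≫ baseChangeHomFst (conjAut : ℂ ≃+* ℂ).toRingHom ((baseChangeHom τ).obj X) ≫ baseChangeHomFst τ X =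
        Spec.map (CommRingCat.ofHom (conjAut : ℂ ≃+* ℂ).toRingHom) ≫ P.left := by
    rintro _ rfl
    exact (AlgPoints.toSpecHom_toConjugate_comp_conjFst_assoc _ _).trans
      (congrArg (fun t => Spec.map (CommRingCat.ofHom (conjAut : ℂ ≃+* ℂ).toRingHom) ≫ t)
        (AlgPoints.baseChangeEquiv_apply_left_comp_fst τ X P))
  rw [AlgPoints.baseChangeEquiv_symm_apply_left, AlgPoints.map_apply, Over.comp_left, Category.assoc,
    baseChangeHomObjIsoOfComp_hom_left_fst, h4 _ rfl]
  rfl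

end Points

/-! ## §2 Galois: `Aut(ℂ/τ̄L)` versus `Aut(ℂ/τL)` and the Artin correspondence -/

section Galois

variable {L : Type} [Field L] (τ : L →+* ℂ)

/-- Re-typing `σ ∈ Aut(ℂ/τ̄L)` as `conj ∘ σ ∘ conj ∈ Aut(ℂ/τL)` (✔ `algEquivTwist` along `τ = conj ∘ τ̄`) and twisting back along
`τ̄ = conj ∘ τ` returns `σ` (`conj ∘ conj = 1`). [folklore] -/
theorem algEquivTwist_conjEmb_algEquivTwist (σ : letI := (conjEmb τ).toAlgebra; ℂ ≃ₐ[L] ℂ) :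
    algEquivTwist (conjEmb_eq τ) (algEquivTwist (eq_starRingAut_comp_conjEmb τ) σ) = σ := by
  letI := (conjEmb τ).toAlgebra
  refine AlgEquiv.ext fun z => ?_
  change star (star (σ (star (star z)))) = σ z
  rw [star_star, star_star]

variable [NumberField L] [IsCMField L]

omit [IsCMField L] in
/-- **The Artin correspondence along the conjugate embedding.**  If `σ ∈ Aut ℂ` and the finite idèle `s` of `L` correspond under
the Artin map for the embedding `τ̄ = conj ∘ τ` ([Milne2005ShimuraVarieties] (59): along some `L`-embedding `e : L̄ → ℂ` over `τ̄`,
`σ` restricts to a `γ ∈ Gal(L̄/L)` with `γ|_{L^{ab}} = art(s)`), then `conj ∘ σ ∘ conj` and the SAME `s` correspond for `τ`: along the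
`L`-embedding `conj ∘ e` over `τ` it restricts to the same `γ`.  (Elementary; no class field theory is used.)
[cite: Milne2005ShimuraVarieties, (59) p. 107] -/
theorem isArtinCorrespondent_of_conjEmb (s : (FiniteAdeleRing (𝓞 L) L)ˣ) (σ σ' : ℂ ≃+* ℂ)
    (hσ' : ∀ z : ℂ, σ' z = star (σ (star z))) (h : IsArtinCorrespondent L (conjEmb τ) s σ) :
    IsArtinCorrespondent L τ s σ' := by
  obtain ⟨⟨f, hf⟩, γ, he, hγ⟩ := h
  -- the `L`-embedding `conj ∘ e : L̄ → ℂ` over `τ` (`conj (e x) = conj (τ̄ x) = τ x` on `L`)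
  let e' : (letI := τ.toAlgebra; AlgebraicClosure L →ₐ[L] ℂ) :=
    letI := τ.toAlgebra
    { toRingHom := (starRingEnd ℂ).comp f
      commutes' := fun x => by
        have hfx : f (algebraMap L (AlgebraicClosure L) x) = star (τ x) := hf x
        change star (f (algebraMap L (AlgebraicClosure L) x)) = τ x
        rw [hfx, star_star] }
  unfold IsArtinCorrespondent
  refine ⟨e', γ, fun x => ?_, hγ⟩
  -- `conj (e (γ x)) = conj (σ (e x)) = (conj ∘ σ ∘ conj) (conj (e x))`
  have hex : f (Field.absoluteGaloisGroup.toAlgEquiv L γ x) = σ (f x) := he x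
  change star (f (Field.absoluteGaloisGroup.toAlgEquiv L γ x)) = σ' (star (f x))
  rw [hex, hσ', star_star]

end Galois

/-! ## §3 The diagonal CM pairs at `(τ̄, T̄)` versus at `(τ, T)` -/

section LinePoint

variable (L : Type) [Field L] (τ : L →+* ℂ) (T : GL (Fin 3) ℂ)

/-- **`x` is on the line `L·v₃` for `(τ̄, T̄)` iff `x̄` is on it for `(τ, T)`**: `T̄ (x,1) ∈ ℂˣ τ̄(v₃)` ⟺ (apply `conj`)
`T (x̄,1) ∈ ℂˣ τ(v₃)` (same `v₃`; the scalar is conjugated). [cite: Milne2005ShimuraVarieties, Def. 12.5 and Rem. 12.6 p. 113] -/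
theorem isLinePoint_conjEmb_conjFrame_iff (v₃ : Fin 3 → L) (x : Ball) :
    IsLinePoint L (conjEmb τ) (conjFrame T) v₃ x ↔ IsLinePoint L τ T v₃ (conjBall x) := by
  have e1 : ((conjFrame T : GL (Fin 3) ℂ) : Matrix (Fin 3) (Fin 3) ℂ) *ᵥ BallModel.lift x =
      star ((T : Matrix (Fin 3) (Fin 3) ℂ) *ᵥ BallModel.lift (conjBall x)) := by
    rw [lift_conjBall, ← conjFrame_mulVec_star, star_star]
  have e2 : ∀ c : ℂ, star (c • fun i => conjEmb τ (v₃ i)) = star c • fun i => τ (v₃ i) := fun c => by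
    ext i
    simp [Pi.smul_apply]
  have e3 : ∀ c : ℂ, star (c • fun i => τ (v₃ i)) = star c • fun i => conjEmb τ (v₃ i) := fun c => by
    ext i
    simp [Pi.smul_apply]
  constructor
  · rintro ⟨c, hc, hx⟩
    refine ⟨star c, star_ne_zero.2 hc, ?_⟩
    have h := congrArg star hx
    rwa [e1, star_star, e2] at h
  · rintro ⟨c, hc, hx⟩
    refine ⟨star c, star_ne_zero.2 hc, ?_⟩
    rw [e1, hx, e3]

end LinePoint

/-! ## §4 Reciprocity (B2-62) and the record system along `τ̄` (B2-R) -/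

section AlongConj

variable {L : Type} [Field L] [NumberField L] [IsCMField L] {H : Matrix (Fin 3) (Fin 3) L}
  {τ : L →+* ℂ} {T : GL (Fin 3) ℂ} {hT : formCongr (starRingEnd ℂ) T (H.map τ) = BallModel.J}
  {K₀ : C5.OpenCompactSubgroup ↥(finAdelic (↥(maximalRealSubfield L)) L (IsCMField.complexConj L) 3 H)}

set_option maxHeartbeats 400000 in
/-- **(B2-62) Shimura reciprocity at the diagonal CM pairs for `(H, τ̄, T̄)` on the SAME models**, read through the form isomorphism
`e := modelsAlongConjIso R.M τ` and the points of `Sc' := alongConj R_ℂ` — the `recip` hypothesis of ✔ `recordSystem_exists_of_descent`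
at `(τ̄, T̄, Sc', R.M, e)`.  Proof: by (P_ℂ) (`alongConj_pts_symm_mk_record`, `rfl`) and §1 the point in question is the twist
`Spec(conj) ≫ (R.pts K)⁻¹[x̄, aK]`; for `σ ∈ Aut(ℂ/τ̄L)` with `art(s) = σ` put `γ := conj ∘ σ ∘ conj ∈ Aut(ℂ/τL)`: `art(s) = γ` at `τ`
(§2), `x̄` is a line point of `v₃` for `(τ, T)` (§3), the twist `d` of `v₃` by `c(s)/s` is unchanged, so `R.recip` gives
`γ • (R.pts K)⁻¹[x̄, aK] = (R.pts K)⁻¹[x̄, d·aK]`, and the twist intertwines `γ` with `σ` (✔ `twist_smul`).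
[cite: Milne2005ShimuraVarieties, Def. 12.8 (62) p. 114] [cite: Deligne1979ShimuraVarieties, 2.2.4–2.2.5 (PDF p. 29 of Milne's translation)] -/
theorem recip_alongConj (R : RecordSystem L H τ T hT K₀) :
    letI : Algebra L ℂ := ((starRingEnd ℂ).comp τ).toAlgebra
    ∀ (K : C5.SmallLevel K₀) (σ : ℂ ≃ₐ[L] ℂ) (s : (FiniteAdeleRing (𝓞 L) L)ˣ),
      IsArtinCorrespondent L ((starRingEnd ℂ).comp τ) s σ.toRingEquiv →
      ∀ (v₃ : Fin 3 → L) (x : Ball), IsLinePoint L ((starRingEnd ℂ).comp τ) (conjFrame T) v₃ x →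
        ∀ d : finAdelic (↥(maximalRealSubfield L)) L (IsCMField.complexConj L) 3 H,
          IsDiagTwist L H v₃ (recipFactor L s) d →
          ∀ a : finAdelic (↥(maximalRealSubfield L)) L (IsCMField.complexConj L) 3 H,
            σ • (AlgPoints.baseChangeEquiv ((starRingEnd ℂ).comp τ) (R.M.obj K)).symm
                (AlgPoints.map ((modelsAlongConjIso R.M τ).inv.app K)
                  (((ComplexRecordSystem.alongConj R.complexRecordSystem).pts K).symm
                    (ShimuraSet.mk L H ((starRingEnd ℂ).comp τ) (conjFrame T)
                      (formCongr_conjFrame_starRingEnd_comp H τ T hT) K.1.1 x a))) =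
              (AlgPoints.baseChangeEquiv ((starRingEnd ℂ).comp τ) (R.M.obj K)).symm
                (AlgPoints.map ((modelsAlongConjIso R.M τ).inv.app K)
                  (((ComplexRecordSystem.alongConj R.complexRecordSystem).pts K).symm
                    (ShimuraSet.mk L H ((starRingEnd ℂ).comp τ) (conjFrame T)
                      (formCongr_conjFrame_starRingEnd_comp H τ T hT) K.1.1 x (d * a)))) := by
  letI : Algebra L ℂ := ((starRingEnd ℂ).comp τ).toAlgebra
  intro K σ s hs v₃ x hx d hd a
  -- (P) + §1: the points read through `e⁻¹` and `Sc'.pts` are the twists `Spec(conj) ≫ ·` of the record's points `[x̄, bK]`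
  have hP : ∀ b : finAdelic (↥(maximalRealSubfield L)) L (IsCMField.complexConj L) 3 H,
      (AlgPoints.baseChangeEquiv ((starRingEnd ℂ).comp τ) (R.M.obj K)).symm
          (AlgPoints.map ((modelsAlongConjIso R.M τ).inv.app K)
            (((ComplexRecordSystem.alongConj R.complexRecordSystem).pts K).symm
              (ShimuraSet.mk L H ((starRingEnd ℂ).comp τ) (conjFrame T)
                (formCongr_conjFrame_starRingEnd_comp H τ T hT) K.1.1 x b))) =
        twist (conjEmb_eq τ) (letI := τ.toAlgebra; (R.pts K).symm (ShimuraSet.mk L H τ T hT K.1.1 (conjBall x) b)) := by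
    intro b
    rw [modelsAlongConjIso_inv_app, ComplexRecordSystem.alongConj_pts_symm_mk_record]
    exact twist_conjEmb_eq_baseChangeEquiv_symm τ (R.M.obj K) _
  -- §2/§3: the re-typed automorphism `γ := conj ∘ σ ∘ conj ∈ Aut(ℂ/τL)` and the transported data of the diagonal pair
  have hγσ : algEquivTwist (conjEmb_eq τ) (algEquivTwist (eq_starRingAut_comp_conjEmb τ) σ) = σ :=
    algEquivTwist_conjEmb_algEquivTwist τ σ
  have hs' : IsArtinCorrespondent L τ s
      (letI := τ.toAlgebra; (algEquivTwist (eq_starRingAut_comp_conjEmb τ) σ).toRingEquiv) :=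
    isArtinCorrespondent_of_conjEmb τ s σ.toRingEquiv _ (fun _ => rfl) hs
  have hx' : IsLinePoint L τ T v₃ (conjBall x) := (isLinePoint_conjEmb_conjFrame_iff L τ T v₃ x).1 hx
  have key := R.recip K (algEquivTwist (eq_starRingAut_comp_conjEmb τ) σ) s hs' v₃ (conjBall x) hx' d hd a
  rw [hP a, hP (d * a), ← key, twist_smul, hγσ]

/-- **B2 — the record system ALONG THE CONJUGATE EMBEDDING, with the SAME models.**  For Deligne's record system `R` of
`Sh(U(H), 𝔹²)` below `K₀` read at `(τ, T)` there is a record system of the SAME hermitian space `H`, below the SAME `K₀`, read at the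
conjugate embedding `τ̄ = conj ∘ τ` with the conjugate frame `T̄ = conjFrame T`, whose models ARE `R.M` (`R'.M = R.M` on the nose):
✔ `recordSystem_exists_of_descent` at the complex record system `alongConj R_ℂ` (`K ↦ ((M_K)_τ)^{conj}`, B2-ℂ), the form isomorphism
`modelsAlongConjIso R.M τ : (M_K)_{τ̄} ≅ ((M_K)_τ)^{conj}` (B2-e) and the reciprocity `recip_alongConj` (B2-62).  ([Milne2005ShimuraVarieties]
§12: the canonical model of `(G, X)` does not depend on the chosen point of `X⁺ ⊔ X⁻`; here the passage `h ↦ h̄`.)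
[cite: Deligne1979ShimuraVarieties, 2.2.5 (PDF p. 29 of Milne's translation)] [cite: Milne2005ShimuraVarieties, §12 and Def. 12.8 (62) p. 114] -/
theorem RecordSystem.exists_alongConj (R : RecordSystem L H τ T hT K₀) :
    ∃ R' : RecordSystem L H ((starRingEnd ℂ).comp τ) (conjFrame T) (formCongr_conjFrame_starRingEnd_comp H τ T hT) K₀,
      R'.M = R.M :=
  recordSystem_exists_of_descent (ComplexRecordSystem.alongConj R.complexRecordSystem) R.M R.smooth R.projective
    (modelsAlongConjIso R.M τ) (recip_alongConj R)

end AlongConj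

end Summit.HodgeConjecture.CorCM.Model.RecordSystemConj

end
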